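import Summits.QuantumFields.YangMills.Theorems.BalabanUVNodesSpineReadingOfRecord13CoPHKRatioDominationBanked
import Summits.QuantumFields.YangMills.Theorems.BalabanUVNodesN20BankedRecordPriceEndToEnd

/-!
# N20 (NE7b) ON THE TOWER-FREE ROAD, END TO END AT THE DICTIONARY: the CoPHK-carrier face of road [e] with the `Banking` per level AND the menus STRUCK BY NAME — labels = CONSISTENT,
# well-formed, pending, CHRONOLOGICAL genealogies of `pub-balaban`'s dictionary `Gen PEv` within the caps, activities = the printed shapes' raw factors along the run's flow letters; ONE
# infrared threshold `x₀` from the symbolic constants (`T4PrintedShapeBanking.exists_irThreshold`); then, at EVERY carrier tuple, the letters (a) + the removal ∕ filing ∕ labelling data (b)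
# + the fibre multiplicities and caps (ID) + the typed flow past `x₀` ⇒ `RelWeightBound 1 … (K ↦ 1 − exp(−S_K))`, `S_K = birthMass·e^{−κ₁}·V·r^{K − j⋆(K) + 1}∕(1 − r)`, `r = Λ·e^{η̄₊−κ₁}`

Cell `pub-ymgap`, YM-PLAN Track A (HUMAN RULING D-0062); seat `pub-ymgap-dag-n20-d` (R134 (a) N20 NE7b s3), gen 42 — director-ym №374 line (E), road [e] TOWER-FREE of record (№377);
candidate (ii) of the seat's memo `N20-R1-STRUCK.g41.md` §4 (evidence on stmt-QuantumFields-27366) with (B) and the menus struck.  `--kind proof --supports stmt-QuantumFields-27366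
--as helper` (K3⁸); COUNT-NEUTRAL; THEOREMS ONLY (0 `def`).  [IV] = [Balaban1989LargeFieldI]; [LF-II] = [Balaban1989LargeFieldII]; [III] = [Balaban1988Convergent].
Companions BY NAME: `…CoPHKRatioDominationBanked.relWeightBound_twoRate_of_fibreDomLetters_banked` (gen 40, p771762), `…N20BankedRecordPriceEndToEnd.sum_stock_le_twoRate_of_chronoLabels`
(gen 41, p775969), and `pub-balaban`'s `T4PrintedShapeBanking.{Consts, Consistent, cost, credit, Emarg, reserve, extn, exists_irThreshold}`, `T4CanonicalMenus.{Chrono, fuel,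
canonFam, birthMass}`, `T4BankedInduction.{Banking, credits, lifeCost}`, `T4PersistenceDictionary.{Gen, PEv, dictW}`.

WHY.  ✓p779254 `relWeightBound_branchingGenealogies_of_fibreDomLetters` displayed, per run, generic labels `G : X → Gen ε`, the menus `Lren ∕ Lmer ∕ Lpart ∕ Lb ∕ n` with their four
budgets, the step-faithfulness `hst`, the family memberships `hfam`, and ONE abstract `Banking` per level `hB`.  On `pub-balaban`'s dictionary `ε := PEv` all of these but the labelling
itself are theorems: the menus and budgets are the CANONICAL ones (`T4CanonicalMenus`: `a = μ = e^{−E₀}`, `ν = ρ̄ = birthMass C`), the shape membership follows from consistency +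
CHRONOLOGY + the class ∕ fuel caps (`mem_canonFam_of_chrono`) — both folded in ✓p775969 `sum_stock_le_twoRate_of_chronoLabels` —, and the printed-shape data INHABIT `Banking` along every
run of the typed flow (2.7) ∕ (2.9) ∕ (2.5) past ONE infrared threshold (`exists_irThreshold`).  THIS FILE composes them at the CoPHK carriers of record.

WHAT IS PROVED (kernel; compositions BY NAME; zero `sorry`).  §1 ★★★ `relWeightBound_chronoGenealogies_of_fibreDomLetters` — the face at the dictionary: flow letters `(R K, g K)` per
level `K₀ + K` (run A at cutoff `K` reads level `K₀ + K`, run B reads level `K₀ + K + 1`), ONE printed-shape `Banking` per level displayed (`hB`), a nonnegative profile, caps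
`Dcap, Ncap`; per `(K, t)`, `|t| ≤ 1`, EACH RUN: removal map with good images, fibre sets, factors with the fibrewise letter on the bad-key histories and the factor clause
`z s ≤ Π_{Y ∈ φ σ s} e^{−credits(G Y)}·e^{+lifeCost(G Y)}` in the printed shapes of the level's flow, stocks with fibre injections, birth slots older than the cut in cells `#Cell a ≤ V·Λ^a`,
labels consistent ∕ well-formed ∕ pending ∕ chronological ∕ births of class `< Dcap` ∕ fuel `≤ Ncap` ∕ rooted at the slot's step, multiplicities `#fibre(slot, shape) ≤ M^{partnerAges}`
over the canonical family; the age datum `M·e^{−κ₁}·e^{η̄₊} < 1` with its ONE side condition, the root rate `Λ·e^{η̄₊−κ₁} < 1`, a cut `j⋆(K) ≤ K` with `c·K ≤ K − j⋆(K)` ⇒ `RelWeightBound`.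
§2 ★★★ `exists_irThreshold_relWeightBound_chronoGenealogies` — §1 ∘ `exists_irThreshold`: for valid constants with `a, A₀, μ > 0`, `L ≥ 1`, `β₀ ≥ 0`, `r(q′+1) < p₀` there is ONE `x₀`
(constants only) such that FOR EVERY carrier tuple `(θ, hP, K₀, g₀, os, kr, bd)`, every family of per-level runs `(R K, g K, β′ K)` of the typed flow with `1 ≤ log g_s⁻²` and
`x₀ ≤ log g⁻²` at the level, §1's letters ∕ labels ∕ multiplicities give `RelWeightBound` — (B) is no longer a hypothesis; `x₀` is chosen BEFORE the family, the rank and the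
carriers (uniformity visible in the quantifier order).  The OF-RECORD pins (birth cells := the boxes of the family's torus, `V = ℓ^4`, `Λ = L^4` by ✓p774413 `card_boxCells_le`; the flow
letters := the histories of record `histA₁₃`) are one `exact` away and left to a sibling leaf, to keep this file one topic.

WHAT STAYS DISPLAYED (the census of road [e] after this file; each NOT PRINTED as a theorem of [LF-II] for `d = 4` and NOT proved here): (a) the fibrewise letters with their factor
clause (an ESTIMATE; junction NC-NE7b-α UNRULED — [LF-II] (1.79) p. 383 + (1.89)⁺ p. 387 READ on [IV] (0.3)'s fibre ratio; `pub-balaban`'s R3′); (b) removal maps with good images,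
fibre injections, slot filing and the genealogy LABELS with consistency ∕ well-formedness ∕ pendency ∕ chronology ∕ caps ∕ roots (a DEFINER object on def-T's index — post-campaign
design memo per №374); (ID) the fibre multiplicities `M^{partnerAges}` (partners' birth cells), the caps, the age datum's ONE side condition and the root rate (entropy numerics); the
per-level runs of the typed (2.7) ∕ (2.9) ∕ (2.5) [III] with `1 ≤ log g_s⁻²`, the infrared smallness `x₀ ≤ log g⁻²` and a nonnegative profile (the node owners of the flow); the
identification of `Consts`, the dictionary's events, windows and caps with print's objects is READING (ID) (`pub-balaban`'s).  The flow letters `g K` are displayed FREE (the history of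
record `histA₁₃ θ K₀ g₀ K` is the intended reading; the letters (a) are stated in the credits of the displayed `g K`, so a degenerate choice only moves the burden into (a)).

HONEST FRAMING.  [bookkeeping]: two compositions; no estimate.  NOTHING of Bałaban's is asserted; NO weight of Bałaban's is bounded; NE7 ∕ NE7b ∕ NE7c NOT PRINTED for `d = 4` ∕ NOT
proved; no `Provisos₁₃CoPH` inhabitant claimed (K0⁷ OPEN); K3⁸ untouched; N20 NOT discharged; counts UNMOVED (typed 28∕28 · discharged 8∕27); one finite four-torus programme at fixed `ε`
— NOT ℝ⁴, NOT OS, NOT a mass gap, NOT the Clay problem.  No `def`, no `instance`, no `notation`, no `sorry`; no decl below carries a cite tag.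
-/

noncomputable section

open MeasureTheory
open scoped BigOperators
open Finset

namespace YMDAG.UVSplit

open Literature.MathematicalPhysics.QuantumFieldTheory.Balaban1983to89
open Literature.MathematicalPhysics.QuantumFieldTheory.Balaban1983to89.T4Continuum
open Literature.MathematicalPhysics.QuantumFieldTheory.Balaban1983to89.Node00
open Literature.MathematicalPhysics.QuantumFieldTheory.Balaban1983to89.B15.BasicStep (fibreIntegral)
open T4WeightBudget (RelWeightBound)
open T4PersistenceDictionary (Gen PEv dictW)
open T4BankedInduction (Banking credits lifeCost)
open T4PartnerMultiplicity (partnerAges)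
open T4BranchingRecordsGas (relabel shape)
open T4PrintedShapeBanking (Consistent Emarg exists_irThreshold)
open T4CanonicalMenus (Chrono fuel canonFam birthMass birthMass_nonneg)

variable {F : T4Family} {N : ℕ} [NeZero N]

/-! ## §1 The face at the dictionary: ONE printed-shape `Banking` per level displayed -/

section Face

variable (θ : Stage13HParams F N) (hP : θ.Provisos₁₃CoPH F N) (K₀ : ℕ) (g₀ : ℕ → ℝ) (os : List (ULoop F))
  (kr : ℕ → (Σ K, SiteSeqKey F (K₀ + K)) → (Σ K, SiteSeqKey F (K₀ + K))) (bd : ℕ → (Σ K, SiteSeqKey F (K₀ + K)) → Prop)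

open scoped Classical in
/-- ★★★ **THE N20 FACE ON THE TOWER-FREE ROAD AT THE DICTIONARY** (any bad-key reading `bd`): symbolic constants `C` with `κ₁ ≥ 0`, `μ > 0`; cells `#Cell a ≤ V·Λ^a` (`V ≥ 0`, `Λ > 0`); an
age datum `M ≥ 0`, `η̄₊ ≥ 0` with `M·e^{−κ₁}·e^{η̄₊} < 1` and the ONE side condition; root rate `Λ·e^{η̄₊−κ₁} < 1`; a cut `j⋆(K) ≤ K` with `c·K ≤ K − j⋆(K)`; per level `K₀ + K` flow letters
`(R K, g K)` with ONE printed-shape `Banking` (`hB`) and a nonnegative profile; caps `Dcap, Ncap`; per `(K, t)`, `|t| ≤ 1`, EACH RUN (A at level `K₀ + K`, B at level `K₀ + K + 1`): removal map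
with good images, fibre sets, factors with the fibrewise letter on the bad-key histories and the factor clause in the printed raw factors of the level's flow, stocks with fibre injections,
birth slots older than the run's cut in cells, labels consistent ∕ well-formed ∕ pending ∕ chronological ∕ within the caps ∕ rooted at the slot's step, fibre multiplicities
`#fibre(slot, shape) ≤ M^{partnerAges}` over the canonical family; displayed measurability ∕ integrability ⇒ `RelWeightBound 1 (classSetK₁₃ …) (weightAK₁₃ …) (weightBK₁₃ …) (badClassK₁₃ … bd)
(K ↦ 1 − exp(−S_K))`, `S_K = birthMass C·e^{−κ₁}·V·r^{K − j⋆(K) + 1}∕(1 − r)`, `r = Λ·e^{η̄₊−κ₁}`. [bookkeeping] -/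
theorem relWeightBound_chronoGenealogies_of_fibreDomLetters {X γ : Type*} [DecidableEq γ] (C : T4PrintedShapeBanking.Consts) (hκ : 0 ≤ C.κ₁) (hμ₀ : 0 < C.μ)
    {V Λ ηplus M c : ℝ} (hV : 0 ≤ V) (hΛ : 0 < Λ) (hηplus : 0 ≤ ηplus) (hM : 0 ≤ M) (hr : Λ * Real.exp (ηplus - C.κ₁) < 1)
    (h1 : M * Real.exp (-C.κ₁) * Real.exp ηplus < 1)
    (hside : (Real.exp (-C.E₀) + Real.exp (-C.E₀) * birthMass C * (M * Real.exp (-C.κ₁) / (1 - M * Real.exp (-C.κ₁) * Real.exp ηplus))) * Real.exp ηplus ≤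
      Real.exp ηplus - 1)
    (hc : 0 < c) {jstar : ℕ → ℕ} (hjK : ∀ K, jstar K ≤ K) (hfrac : ∀ K : ℕ, c * K ≤ ((K - jstar K : ℕ) : ℝ))
    (Cell : ℕ → Finset γ) (hcell : ∀ a, ((Cell a).card : ℝ) ≤ V * Λ ^ a) (R : ℕ → ℕ → ℕ) (g : ℕ → ℕ → ℝ)
    (hB : ∀ K, Banking (Consistent C (K₀ + K) (R K)) (dictW (R K) C.n₁) (T4PrintedShapeBanking.cost C (K₀ + K) (R K)) (T4PrintedShapeBanking.credit C (g K))
      (fun e => C.κ₁ * ((dictW (R K) C.n₁ e : ℕ) : ℝ) + Emarg C e) (T4PrintedShapeBanking.reserve C (g K)) (T4PrintedShapeBanking.extn C (K₀ + K) (R K)))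
    (hprof : ∀ K j, 0 ≤ p0Profile C.A₀ C.p₀ (g K j)) (Dcap Ncap : ℕ → ℕ)
    (hmA : ∀ K t s, Measurable fun V => chiSeqOfRecord F N θ.ν θ.τ9.M (histA₁₃ θ K₀ g₀ K) (K₀ + K) (K₀ + K) s V *
      dressedSlotsOfDatum₉ F N θ.toStage9Params (datumOfRecord₁₃CoPH F N θ hP) g₀ os t (runA₁₃ F K₀ g₀ K) (histA₁₃ θ K₀ g₀ K) (K₀ + K) s V)
    (hintA : ∀ K t s, Integrable (fun V => chiSeqOfRecord F N θ.ν θ.τ9.M (histA₁₃ θ K₀ g₀ K) (K₀ + K) (K₀ + K) s V *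
      dressedSlotsOfDatum₉ F N θ.toStage9Params (datumOfRecord₁₃CoPH F N θ hP) g₀ os t (runA₁₃ F K₀ g₀ K) (histA₁₃ θ K₀ g₀ K) (K₀ + K) s V)
      (fieldMeasure (F.P (K₀ + K)) (K₀ + K) (SU N)))
    (hmB : ∀ K t s', Measurable fun V => chiSeqOfRecord F N θ.ν θ.τ9.M (histB₁₃ θ K₀ g₀ K) (K₀ + K + 1) (K₀ + K + 1) s' V *
      dressedSlotsOfDatum₉ F N θ.toStage9Params (datumOfRecord₁₃CoPH F N θ hP) g₀ os t (runB₁₃ F K₀ g₀ K) (histB₁₃ θ K₀ g₀ K) (K₀ + K + 1) s' V)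
    (hintB : ∀ K t s', Integrable (fun V => chiSeqOfRecord F N θ.ν θ.τ9.M (histB₁₃ θ K₀ g₀ K) (K₀ + K + 1) (K₀ + K + 1) s' V *
      dressedSlotsOfDatum₉ F N θ.toStage9Params (datumOfRecord₁₃CoPH F N θ hP) g₀ os t (runB₁₃ F K₀ g₀ K) (histB₁₃ θ K₀ g₀ K) (K₀ + K + 1) s' V)
      (fieldMeasure (F.P (K₀ + K + 1)) (K₀ + K + 1) (SU N)))
    (hLA : ∀ (K : ℕ) (t : ℝ), |t| ≤ 1 →
      ∃ (rm : SeqOfRecord F θ.ν θ.τ9.M (histA₁₃ θ K₀ g₀ K) (K₀ + K) (K₀ + K) → SeqOfRecord F θ.ν θ.τ9.M (histA₁₃ θ K₀ g₀ K) (K₀ + K) (K₀ + K))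
        (fib : SeqOfRecord F θ.ν θ.τ9.M (histA₁₃ θ K₀ g₀ K) (K₀ + K) (K₀ + K) → Finset (PBond (F.P (K₀ + K)) (K₀ + K)))
        (z : SeqOfRecord F θ.ν θ.τ9.M (histA₁₃ θ K₀ g₀ K) (K₀ + K) (K₀ + K) → ℝ) (Old : SeqOfRecord F θ.ν θ.τ9.M (histA₁₃ θ K₀ g₀ K) (K₀ + K) (K₀ + K) → Finset X)
        (φ : SeqOfRecord F θ.ν θ.τ9.M (histA₁₃ θ K₀ g₀ K) (K₀ + K) (K₀ + K) → SeqOfRecord F θ.ν θ.τ9.M (histA₁₃ θ K₀ g₀ K) (K₀ + K) (K₀ + K) → Finset X)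
        (slot : X → (Σ _ : ℕ, γ)) (G : X → Gen PEv),
        (∀ s, kr K (keyA₁₃ θ K₀ g₀ K s) ∈ badClassK₁₃ θ K₀ g₀ kr bd K t → ∀ V,
          fibreIntegral (fib s) (fun V => chiSeqOfRecord F N θ.ν θ.τ9.M (histA₁₃ θ K₀ g₀ K) (K₀ + K) (K₀ + K) s V *
              dressedSlotsOfDatum₉ F N θ.toStage9Params (datumOfRecord₁₃CoPH F N θ hP) g₀ os t (runA₁₃ F K₀ g₀ K) (histA₁₃ θ K₀ g₀ K) (K₀ + K) s V) V ≤
            z s * fibreIntegral (fib s) (fun V => chiSeqOfRecord F N θ.ν θ.τ9.M (histA₁₃ θ K₀ g₀ K) (K₀ + K) (K₀ + K) (rm s) V *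
              dressedSlotsOfDatum₉ F N θ.toStage9Params (datumOfRecord₁₃CoPH F N θ hP) g₀ os t (runA₁₃ F K₀ g₀ K) (histA₁₃ θ K₀ g₀ K) (K₀ + K) (rm s) V) V) ∧
        (∀ s, kr K (keyA₁₃ θ K₀ g₀ K s) ∈ badClassK₁₃ θ K₀ g₀ kr bd K t → kr K (keyA₁₃ θ K₀ g₀ K (rm s)) ∉ badClassK₁₃ θ K₀ g₀ kr bd K t) ∧
        (∀ σ s, kr K (keyA₁₃ θ K₀ g₀ K s) ∈ badClassK₁₃ θ K₀ g₀ kr bd K t → rm s = σ → φ σ s ⊆ Old σ ∧ (φ σ s).Nonempty) ∧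
        (∀ σ, Set.InjOn (φ σ) {s | kr K (keyA₁₃ θ K₀ g₀ K s) ∈ badClassK₁₃ θ K₀ g₀ kr bd K t ∧ rm s = σ}) ∧
        (∀ σ s, kr K (keyA₁₃ θ K₀ g₀ K s) ∈ badClassK₁₃ θ K₀ g₀ kr bd K t → rm s = σ →
          z s ≤ ∏ Y ∈ φ σ s, Real.exp (-credits (T4PrintedShapeBanking.credit C (g K)) (G Y)) *
            Real.exp (lifeCost (dictW (R K) C.n₁) (T4PrintedShapeBanking.cost C (K₀ + K) (R K)) (G Y))) ∧
        (∀ σ, ∀ Y ∈ Old σ, (slot Y).1 < K₀ + jstar K) ∧ (∀ σ, ∀ Y ∈ Old σ, (slot Y).2 ∈ Cell ((K₀ + K) - (slot Y).1)) ∧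
        (∀ σ, ∀ Y ∈ Old σ, Consistent C (K₀ + K) (R K) (G Y)) ∧ (∀ σ, ∀ Y ∈ Old σ, (G Y).WF (dictW (R K) C.n₁)) ∧
        (∀ σ, ∀ Y ∈ Old σ, K₀ + K < (G Y).reach (dictW (R K) C.n₁)) ∧ (∀ σ, ∀ Y ∈ Old σ, Chrono PEv.step (G Y)) ∧
        (∀ σ, ∀ Y ∈ Old σ, ∀ e ∈ (G Y).events, e.kind = 0 → e.fat < Dcap (K₀ + K)) ∧ (∀ σ, ∀ Y ∈ Old σ, fuel (G Y) ≤ Ncap (K₀ + K)) ∧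
        (∀ σ, ∀ Y ∈ Old σ, (G Y).rootStep = (slot Y).1) ∧
        (∀ σ, ∀ j < K₀ + jstar K, ∀ zc ∈ Cell ((K₀ + K) - j), ∀ G₀ ∈ canonFam Dcap Ncap (K₀ + K) j,
          ((((Old σ).filter fun Y => slot Y = ⟨j, zc⟩ ∧ relabel shape (G Y) = G₀).card : ℕ) : ℝ) ≤ M ^ partnerAges PEv.step G₀))
    (hLB : ∀ (K : ℕ) (t : ℝ), |t| ≤ 1 →
      ∃ (rm : SeqOfRecord F θ.ν θ.τ9.M (histB₁₃ θ K₀ g₀ K) (K₀ + K + 1) (K₀ + K + 1) → SeqOfRecord F θ.ν θ.τ9.M (histB₁₃ θ K₀ g₀ K) (K₀ + K + 1) (K₀ + K + 1))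
        (fib : SeqOfRecord F θ.ν θ.τ9.M (histB₁₃ θ K₀ g₀ K) (K₀ + K + 1) (K₀ + K + 1) → Finset (PBond (F.P (K₀ + K + 1)) (K₀ + K + 1)))
        (z : SeqOfRecord F θ.ν θ.τ9.M (histB₁₃ θ K₀ g₀ K) (K₀ + K + 1) (K₀ + K + 1) → ℝ) (Old : SeqOfRecord F θ.ν θ.τ9.M (histB₁₃ θ K₀ g₀ K) (K₀ + K + 1) (K₀ + K + 1) → Finset X)
        (φ : SeqOfRecord F θ.ν θ.τ9.M (histB₁₃ θ K₀ g₀ K) (K₀ + K + 1) (K₀ + K + 1) → SeqOfRecord F θ.ν θ.τ9.M (histB₁₃ θ K₀ g₀ K) (K₀ + K + 1) (K₀ + K + 1) → Finset X)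
        (slot : X → (Σ _ : ℕ, γ)) (G : X → Gen PEv),
        (∀ s', kr K (keyB₁₃ θ K₀ g₀ K s') ∈ badClassK₁₃ θ K₀ g₀ kr bd K t → ∀ V,
          fibreIntegral (fib s') (fun V => chiSeqOfRecord F N θ.ν θ.τ9.M (histB₁₃ θ K₀ g₀ K) (K₀ + K + 1) (K₀ + K + 1) s' V *
              dressedSlotsOfDatum₉ F N θ.toStage9Params (datumOfRecord₁₃CoPH F N θ hP) g₀ os t (runB₁₃ F K₀ g₀ K) (histB₁₃ θ K₀ g₀ K) (K₀ + K + 1) s' V) V ≤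
            z s' * fibreIntegral (fib s') (fun V => chiSeqOfRecord F N θ.ν θ.τ9.M (histB₁₃ θ K₀ g₀ K) (K₀ + K + 1) (K₀ + K + 1) (rm s') V *
              dressedSlotsOfDatum₉ F N θ.toStage9Params (datumOfRecord₁₃CoPH F N θ hP) g₀ os t (runB₁₃ F K₀ g₀ K) (histB₁₃ θ K₀ g₀ K) (K₀ + K + 1) (rm s') V) V) ∧
        (∀ s', kr K (keyB₁₃ θ K₀ g₀ K s') ∈ badClassK₁₃ θ K₀ g₀ kr bd K t → kr K (keyB₁₃ θ K₀ g₀ K (rm s')) ∉ badClassK₁₃ θ K₀ g₀ kr bd K t) ∧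
        (∀ σ s', kr K (keyB₁₃ θ K₀ g₀ K s') ∈ badClassK₁₃ θ K₀ g₀ kr bd K t → rm s' = σ → φ σ s' ⊆ Old σ ∧ (φ σ s').Nonempty) ∧
        (∀ σ, Set.InjOn (φ σ) {s' | kr K (keyB₁₃ θ K₀ g₀ K s') ∈ badClassK₁₃ θ K₀ g₀ kr bd K t ∧ rm s' = σ}) ∧
        (∀ σ s', kr K (keyB₁₃ θ K₀ g₀ K s') ∈ badClassK₁₃ θ K₀ g₀ kr bd K t → rm s' = σ →
          z s' ≤ ∏ Y ∈ φ σ s', Real.exp (-credits (T4PrintedShapeBanking.credit C (g (K + 1))) (G Y)) *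
            Real.exp (lifeCost (dictW (R (K + 1)) C.n₁) (T4PrintedShapeBanking.cost C (K₀ + K + 1) (R (K + 1))) (G Y))) ∧
        (∀ σ, ∀ Y ∈ Old σ, (slot Y).1 < K₀ + jstar K + 1) ∧ (∀ σ, ∀ Y ∈ Old σ, (slot Y).2 ∈ Cell ((K₀ + K + 1) - (slot Y).1)) ∧
        (∀ σ, ∀ Y ∈ Old σ, Consistent C (K₀ + K + 1) (R (K + 1)) (G Y)) ∧ (∀ σ, ∀ Y ∈ Old σ, (G Y).WF (dictW (R (K + 1)) C.n₁)) ∧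
        (∀ σ, ∀ Y ∈ Old σ, K₀ + K + 1 < (G Y).reach (dictW (R (K + 1)) C.n₁)) ∧ (∀ σ, ∀ Y ∈ Old σ, Chrono PEv.step (G Y)) ∧
        (∀ σ, ∀ Y ∈ Old σ, ∀ e ∈ (G Y).events, e.kind = 0 → e.fat < Dcap (K₀ + K + 1)) ∧ (∀ σ, ∀ Y ∈ Old σ, fuel (G Y) ≤ Ncap (K₀ + K + 1)) ∧
        (∀ σ, ∀ Y ∈ Old σ, (G Y).rootStep = (slot Y).1) ∧
        (∀ σ, ∀ j < K₀ + jstar K + 1, ∀ zc ∈ Cell ((K₀ + K + 1) - j), ∀ G₀ ∈ canonFam Dcap Ncap (K₀ + K + 1) j,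
          ((((Old σ).filter fun Y => slot Y = ⟨j, zc⟩ ∧ relabel shape (G Y) = G₀).card : ℕ) : ℝ) ≤ M ^ partnerAges PEv.step G₀)) :
    RelWeightBound 1 (classSetK₁₃ θ K₀ g₀ kr) (weightAK₁₃ θ hP K₀ g₀ os kr) (weightBK₁₃ θ hP K₀ g₀ os kr) (badClassK₁₃ θ K₀ g₀ kr bd)
      (fun K => 1 - Real.exp (-(birthMass C * Real.exp (-C.κ₁) * V *
        ((Λ * Real.exp (ηplus - C.κ₁)) ^ (K - jstar K + 1) / (1 - Λ * Real.exp (ηplus - C.κ₁)))))) := by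
  have hr0 : 0 < Λ * Real.exp (ηplus - C.κ₁) := mul_pos hΛ (Real.exp_pos _)
  have hC : 0 ≤ birthMass C * Real.exp (-C.κ₁) := mul_nonneg (birthMass_nonneg hμ₀) (Real.exp_pos _).le
  have hx0 : ∀ (L : ℕ) (Rl : ℕ → ℕ) (gl : ℕ → ℝ) (G : X → Gen PEv) (Y : X),
      0 ≤ Real.exp (-credits (T4PrintedShapeBanking.credit C gl) (G Y)) * Real.exp (lifeCost (dictW Rl C.n₁) (T4PrintedShapeBanking.cost C L Rl) (G Y)) :=
    fun L Rl gl G Y => (mul_pos (Real.exp_pos _) (Real.exp_pos _)).le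
  refine relWeightBound_twoRate_of_fibreDomLetters_banked (X := X) θ hP K₀ g₀ os kr bd hC hV hr0 hr hc hfrac hmA hintA hmB hintB ?_ ?_
  · intro K t ht
    obtain ⟨rm, fib, z, Old, φ, slot, G, hDom, hgood, hφ, hinj, hz, hold, hmem, hcon, hwf, hpend, hchrono, hfat, hfuel, hroot, hcard⟩ := hLA K t ht
    refine ⟨rm, fib, z, Old, φ, fun Y => Real.exp (-credits (T4PrintedShapeBanking.credit C (g K)) (G Y)) *
      Real.exp (lifeCost (dictW (R K) C.n₁) (T4PrintedShapeBanking.cost C (K₀ + K) (R K)) (G Y)), hDom, hgood, fun σ Y _ => hx0 (K₀ + K) (R K) (g K) G Y, hφ, hinj, hz,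
      fun σ => ?_⟩
    have h := sum_stock_le_twoRate_of_chronoLabels C hκ hμ₀ (hB K) (hprof K) Dcap Ncap (Old σ) slot G
      (fun Y => Real.exp (-credits (T4PrintedShapeBanking.credit C (g K)) (G Y)) * Real.exp (lifeCost (dictW (R K) C.n₁) (T4PrintedShapeBanking.cost C (K₀ + K) (R K)) (G Y)))
      Cell hV hΛ.le hcell hM hηplus h1 hside hr (show K₀ + jstar K ≤ K₀ + K from Nat.add_le_add_left (hjK K) K₀) (hold σ) (hmem σ) (hcon σ) (hwf σ) (hpend σ)
      (hchrono σ) (hfat σ) (hfuel σ) (hroot σ) (fun Y _ => le_rfl) (hcard σ)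
    rw [show K₀ + K - (K₀ + jstar K) = K - jstar K by omega] at h
    exact h
  · intro K t ht
    obtain ⟨rm, fib, z, Old, φ, slot, G, hDom, hgood, hφ, hinj, hz, hold, hmem, hcon, hwf, hpend, hchrono, hfat, hfuel, hroot, hcard⟩ := hLB K t ht
    have hB' : Banking (Consistent C (K₀ + K + 1) (R (K + 1))) (dictW (R (K + 1)) C.n₁) (T4PrintedShapeBanking.cost C (K₀ + K + 1) (R (K + 1)))
        (T4PrintedShapeBanking.credit C (g (K + 1))) (fun e => C.κ₁ * ((dictW (R (K + 1)) C.n₁ e : ℕ) : ℝ) + Emarg C e) (T4PrintedShapeBanking.reserve C (g (K + 1)))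
        (T4PrintedShapeBanking.extn C (K₀ + K + 1) (R (K + 1))) := hB (K + 1)
    refine ⟨rm, fib, z, Old, φ, fun Y => Real.exp (-credits (T4PrintedShapeBanking.credit C (g (K + 1))) (G Y)) *
      Real.exp (lifeCost (dictW (R (K + 1)) C.n₁) (T4PrintedShapeBanking.cost C (K₀ + K + 1) (R (K + 1))) (G Y)), hDom, hgood,
      fun σ Y _ => hx0 (K₀ + K + 1) (R (K + 1)) (g (K + 1)) G Y, hφ, hinj, hz, fun σ => ?_⟩
    have h := sum_stock_le_twoRate_of_chronoLabels C hκ hμ₀ hB' (hprof (K + 1)) Dcap Ncap (Old σ) slot G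
      (fun Y => Real.exp (-credits (T4PrintedShapeBanking.credit C (g (K + 1))) (G Y)) *
        Real.exp (lifeCost (dictW (R (K + 1)) C.n₁) (T4PrintedShapeBanking.cost C (K₀ + K + 1) (R (K + 1))) (G Y)))
      Cell hV hΛ.le hcell hM hηplus h1 hside hr (show K₀ + jstar K + 1 ≤ K₀ + K + 1 from Nat.succ_le_succ (Nat.add_le_add_left (hjK K) K₀)) (hold σ) (hmem σ)
      (hcon σ) (hwf σ) (hpend σ) (hchrono σ) (hfat σ) (hfuel σ) (hroot σ) (fun Y _ => le_rfl) (hcard σ)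
    rw [show K₀ + K + 1 - (K₀ + jstar K + 1) = K - jstar K by omega] at h
    exact h

end Face


/-! ## §2 ONE infrared threshold from the constants, then EVERY carrier tuple and EVERY run of the typed flow: (B) struck by name -/

section IRThreshold

open scoped Classical in
/-- ★★★ **THE N20 FACE ON THE TOWER-FREE ROAD WITH THE BANKING STRUCK BY NAME** (§1 ∘ `T4PrintedShapeBanking.exists_irThreshold`): for valid symbolic constants with `a, A₀, μ > 0`,
block size `L ≥ 1`, `β₀ ≥ 0` and the exponent condition `r(q′+1) < p₀` there is ONE number `x₀` — constants only — such that for EVERY family `F`, rank `N`, carrier tuple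
`(θ, hP, K₀, g₀, os, kr, bd)`, cells, age datum with its one side condition, root rate, cut, and EVERY family of per-level runs `(R K, g K, β′ K)` of the typed (2.7) ∕ (2.9) ∕ (2.5) at
level `K₀ + K` with `1 ≤ log g_s⁻²` (`s ≤ K₀ + K`), the infrared smallness `x₀ ≤ log (g K (K₀ + K))⁻²` and a nonnegative profile, §1's letters (a), data and labels (b) and multiplicities ∕
caps (ID) give `RelWeightBound 1 (classSetK₁₃ …) (weightAK₁₃ …) (weightBK₁₃ …) (badClassK₁₃ … bd) (K ↦ 1 − exp(−S_K))` — no `Banking` hypothesis. [bookkeeping] -/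
theorem exists_irThreshold_relWeightBound_chronoGenealogies {X γ : Type*} [DecidableEq γ] (C : T4PrintedShapeBanking.Consts) (hCv : C.Valid) (ha : 0 < C.a)
    (hA : 0 < C.A₀) (hμ₀ : 0 < C.μ) {L r : ℕ} (hL : 1 ≤ L) {β₀ : ℝ} (hβ : 0 ≤ β₀) (hrq : r * (C.q' + 1) < C.p₀) :
    ∃ x₀ : ℝ, ∀ {F : T4Family} {N : ℕ} [NeZero N] (θ : Stage13HParams F N) (hP : θ.Provisos₁₃CoPH F N) (K₀ : ℕ) (g₀ : ℕ → ℝ) (os : List (ULoop F))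
      (kr : ℕ → (Σ K, SiteSeqKey F (K₀ + K)) → (Σ K, SiteSeqKey F (K₀ + K))) (bd : ℕ → (Σ K, SiteSeqKey F (K₀ + K)) → Prop) (V Λ ηplus M c : ℝ),
      0 ≤ V → 0 < Λ → 0 ≤ ηplus → 0 ≤ M → Λ * Real.exp (ηplus - C.κ₁) < 1 → M * Real.exp (-C.κ₁) * Real.exp ηplus < 1 →
      (Real.exp (-C.E₀) + Real.exp (-C.E₀) * birthMass C * (M * Real.exp (-C.κ₁) / (1 - M * Real.exp (-C.κ₁) * Real.exp ηplus))) * Real.exp ηplus ≤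
        Real.exp ηplus - 1 → 0 < c →
      ∀ (jstar : ℕ → ℕ), (∀ K, jstar K ≤ K) → (∀ K : ℕ, c * K ≤ ((K - jstar K : ℕ) : ℝ)) →
      ∀ (Cell : ℕ → Finset γ), (∀ a, ((Cell a).card : ℝ) ≤ V * Λ ^ a) →
      ∀ (R : ℕ → ℕ → ℕ) (g : ℕ → ℕ → ℝ) (β' : ℕ → ℝ),
        (∀ K, B14.FlowIneq27 (g K) (β' K) β₀ C.p₀ (K₀ + K)) → (∀ K, B14FlowStep.FlowIneq29 (R K) (g K) L (β' K) β₀ (K₀ + K)) →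
        (∀ K s, s ≤ K₀ + K → B14.IsRj L r (g K s) (R K s)) → (∀ K s, s ≤ K₀ + K → 1 ≤ Real.log ((g K s) ^ 2)⁻¹) →
        (∀ K, x₀ ≤ Real.log ((g K (K₀ + K)) ^ 2)⁻¹) → (∀ K j, 0 ≤ p0Profile C.A₀ C.p₀ (g K j)) →
      ∀ (Dcap Ncap : ℕ → ℕ),
      (∀ K t s, Measurable fun V => chiSeqOfRecord F N θ.ν θ.τ9.M (histA₁₃ θ K₀ g₀ K) (K₀ + K) (K₀ + K) s V *
        dressedSlotsOfDatum₉ F N θ.toStage9Params (datumOfRecord₁₃CoPH F N θ hP) g₀ os t (runA₁₃ F K₀ g₀ K) (histA₁₃ θ K₀ g₀ K) (K₀ + K) s V) →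
      (∀ K t s, Integrable (fun V => chiSeqOfRecord F N θ.ν θ.τ9.M (histA₁₃ θ K₀ g₀ K) (K₀ + K) (K₀ + K) s V *
        dressedSlotsOfDatum₉ F N θ.toStage9Params (datumOfRecord₁₃CoPH F N θ hP) g₀ os t (runA₁₃ F K₀ g₀ K) (histA₁₃ θ K₀ g₀ K) (K₀ + K) s V)
        (fieldMeasure (F.P (K₀ + K)) (K₀ + K) (SU N))) →
      (∀ K t s', Measurable fun V => chiSeqOfRecord F N θ.ν θ.τ9.M (histB₁₃ θ K₀ g₀ K) (K₀ + K + 1) (K₀ + K + 1) s' V *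
        dressedSlotsOfDatum₉ F N θ.toStage9Params (datumOfRecord₁₃CoPH F N θ hP) g₀ os t (runB₁₃ F K₀ g₀ K) (histB₁₃ θ K₀ g₀ K) (K₀ + K + 1) s' V) →
      (∀ K t s', Integrable (fun V => chiSeqOfRecord F N θ.ν θ.τ9.M (histB₁₃ θ K₀ g₀ K) (K₀ + K + 1) (K₀ + K + 1) s' V *
        dressedSlotsOfDatum₉ F N θ.toStage9Params (datumOfRecord₁₃CoPH F N θ hP) g₀ os t (runB₁₃ F K₀ g₀ K) (histB₁₃ θ K₀ g₀ K) (K₀ + K + 1) s' V)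
        (fieldMeasure (F.P (K₀ + K + 1)) (K₀ + K + 1) (SU N))) →
      (∀ (K : ℕ) (t : ℝ), |t| ≤ 1 →
        ∃ (rm : SeqOfRecord F θ.ν θ.τ9.M (histA₁₃ θ K₀ g₀ K) (K₀ + K) (K₀ + K) → SeqOfRecord F θ.ν θ.τ9.M (histA₁₃ θ K₀ g₀ K) (K₀ + K) (K₀ + K))
          (fib : SeqOfRecord F θ.ν θ.τ9.M (histA₁₃ θ K₀ g₀ K) (K₀ + K) (K₀ + K) → Finset (PBond (F.P (K₀ + K)) (K₀ + K)))
          (z : SeqOfRecord F θ.ν θ.τ9.M (histA₁₃ θ K₀ g₀ K) (K₀ + K) (K₀ + K) → ℝ) (Old : SeqOfRecord F θ.ν θ.τ9.M (histA₁₃ θ K₀ g₀ K) (K₀ + K) (K₀ + K) → Finset X)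
          (φ : SeqOfRecord F θ.ν θ.τ9.M (histA₁₃ θ K₀ g₀ K) (K₀ + K) (K₀ + K) → SeqOfRecord F θ.ν θ.τ9.M (histA₁₃ θ K₀ g₀ K) (K₀ + K) (K₀ + K) → Finset X)
          (slot : X → (Σ _ : ℕ, γ)) (G : X → Gen PEv),
          (∀ s, kr K (keyA₁₃ θ K₀ g₀ K s) ∈ badClassK₁₃ θ K₀ g₀ kr bd K t → ∀ V,
            fibreIntegral (fib s) (fun V => chiSeqOfRecord F N θ.ν θ.τ9.M (histA₁₃ θ K₀ g₀ K) (K₀ + K) (K₀ + K) s V *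
                dressedSlotsOfDatum₉ F N θ.toStage9Params (datumOfRecord₁₃CoPH F N θ hP) g₀ os t (runA₁₃ F K₀ g₀ K) (histA₁₃ θ K₀ g₀ K) (K₀ + K) s V) V ≤
              z s * fibreIntegral (fib s) (fun V => chiSeqOfRecord F N θ.ν θ.τ9.M (histA₁₃ θ K₀ g₀ K) (K₀ + K) (K₀ + K) (rm s) V *
                dressedSlotsOfDatum₉ F N θ.toStage9Params (datumOfRecord₁₃CoPH F N θ hP) g₀ os t (runA₁₃ F K₀ g₀ K) (histA₁₃ θ K₀ g₀ K) (K₀ + K) (rm s) V) V) ∧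
          (∀ s, kr K (keyA₁₃ θ K₀ g₀ K s) ∈ badClassK₁₃ θ K₀ g₀ kr bd K t → kr K (keyA₁₃ θ K₀ g₀ K (rm s)) ∉ badClassK₁₃ θ K₀ g₀ kr bd K t) ∧
          (∀ σ s, kr K (keyA₁₃ θ K₀ g₀ K s) ∈ badClassK₁₃ θ K₀ g₀ kr bd K t → rm s = σ → φ σ s ⊆ Old σ ∧ (φ σ s).Nonempty) ∧
          (∀ σ, Set.InjOn (φ σ) {s | kr K (keyA₁₃ θ K₀ g₀ K s) ∈ badClassK₁₃ θ K₀ g₀ kr bd K t ∧ rm s = σ}) ∧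
          (∀ σ s, kr K (keyA₁₃ θ K₀ g₀ K s) ∈ badClassK₁₃ θ K₀ g₀ kr bd K t → rm s = σ →
            z s ≤ ∏ Y ∈ φ σ s, Real.exp (-credits (T4PrintedShapeBanking.credit C (g K)) (G Y)) *
              Real.exp (lifeCost (dictW (R K) C.n₁) (T4PrintedShapeBanking.cost C (K₀ + K) (R K)) (G Y))) ∧
          (∀ σ, ∀ Y ∈ Old σ, (slot Y).1 < K₀ + jstar K) ∧ (∀ σ, ∀ Y ∈ Old σ, (slot Y).2 ∈ Cell ((K₀ + K) - (slot Y).1)) ∧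
          (∀ σ, ∀ Y ∈ Old σ, Consistent C (K₀ + K) (R K) (G Y)) ∧ (∀ σ, ∀ Y ∈ Old σ, (G Y).WF (dictW (R K) C.n₁)) ∧
          (∀ σ, ∀ Y ∈ Old σ, K₀ + K < (G Y).reach (dictW (R K) C.n₁)) ∧ (∀ σ, ∀ Y ∈ Old σ, Chrono PEv.step (G Y)) ∧
          (∀ σ, ∀ Y ∈ Old σ, ∀ e ∈ (G Y).events, e.kind = 0 → e.fat < Dcap (K₀ + K)) ∧ (∀ σ, ∀ Y ∈ Old σ, fuel (G Y) ≤ Ncap (K₀ + K)) ∧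
          (∀ σ, ∀ Y ∈ Old σ, (G Y).rootStep = (slot Y).1) ∧
          (∀ σ, ∀ j < K₀ + jstar K, ∀ zc ∈ Cell ((K₀ + K) - j), ∀ G₀ ∈ canonFam Dcap Ncap (K₀ + K) j,
            ((((Old σ).filter fun Y => slot Y = ⟨j, zc⟩ ∧ relabel shape (G Y) = G₀).card : ℕ) : ℝ) ≤ M ^ partnerAges PEv.step G₀)) →
      (∀ (K : ℕ) (t : ℝ), |t| ≤ 1 →
        ∃ (rm : SeqOfRecord F θ.ν θ.τ9.M (histB₁₃ θ K₀ g₀ K) (K₀ + K + 1) (K₀ + K + 1) → SeqOfRecord F θ.ν θ.τ9.M (histB₁₃ θ K₀ g₀ K) (K₀ + K + 1) (K₀ + K + 1))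
          (fib : SeqOfRecord F θ.ν θ.τ9.M (histB₁₃ θ K₀ g₀ K) (K₀ + K + 1) (K₀ + K + 1) → Finset (PBond (F.P (K₀ + K + 1)) (K₀ + K + 1)))
          (z : SeqOfRecord F θ.ν θ.τ9.M (histB₁₃ θ K₀ g₀ K) (K₀ + K + 1) (K₀ + K + 1) → ℝ)
          (Old : SeqOfRecord F θ.ν θ.τ9.M (histB₁₃ θ K₀ g₀ K) (K₀ + K + 1) (K₀ + K + 1) → Finset X)
          (φ : SeqOfRecord F θ.ν θ.τ9.M (histB₁₃ θ K₀ g₀ K) (K₀ + K + 1) (K₀ + K + 1) → SeqOfRecord F θ.ν θ.τ9.M (histB₁₃ θ K₀ g₀ K) (K₀ + K + 1) (K₀ + K + 1) → Finset X)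
          (slot : X → (Σ _ : ℕ, γ)) (G : X → Gen PEv),
          (∀ s', kr K (keyB₁₃ θ K₀ g₀ K s') ∈ badClassK₁₃ θ K₀ g₀ kr bd K t → ∀ V,
            fibreIntegral (fib s') (fun V => chiSeqOfRecord F N θ.ν θ.τ9.M (histB₁₃ θ K₀ g₀ K) (K₀ + K + 1) (K₀ + K + 1) s' V *
                dressedSlotsOfDatum₉ F N θ.toStage9Params (datumOfRecord₁₃CoPH F N θ hP) g₀ os t (runB₁₃ F K₀ g₀ K) (histB₁₃ θ K₀ g₀ K) (K₀ + K + 1) s' V) V ≤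
              z s' * fibreIntegral (fib s') (fun V => chiSeqOfRecord F N θ.ν θ.τ9.M (histB₁₃ θ K₀ g₀ K) (K₀ + K + 1) (K₀ + K + 1) (rm s') V *
                dressedSlotsOfDatum₉ F N θ.toStage9Params (datumOfRecord₁₃CoPH F N θ hP) g₀ os t (runB₁₃ F K₀ g₀ K) (histB₁₃ θ K₀ g₀ K) (K₀ + K + 1) (rm s') V) V) ∧
          (∀ s', kr K (keyB₁₃ θ K₀ g₀ K s') ∈ badClassK₁₃ θ K₀ g₀ kr bd K t → kr K (keyB₁₃ θ K₀ g₀ K (rm s')) ∉ badClassK₁₃ θ K₀ g₀ kr bd K t) ∧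
          (∀ σ s', kr K (keyB₁₃ θ K₀ g₀ K s') ∈ badClassK₁₃ θ K₀ g₀ kr bd K t → rm s' = σ → φ σ s' ⊆ Old σ ∧ (φ σ s').Nonempty) ∧
          (∀ σ, Set.InjOn (φ σ) {s' | kr K (keyB₁₃ θ K₀ g₀ K s') ∈ badClassK₁₃ θ K₀ g₀ kr bd K t ∧ rm s' = σ}) ∧
          (∀ σ s', kr K (keyB₁₃ θ K₀ g₀ K s') ∈ badClassK₁₃ θ K₀ g₀ kr bd K t → rm s' = σ →
            z s' ≤ ∏ Y ∈ φ σ s', Real.exp (-credits (T4PrintedShapeBanking.credit C (g (K + 1))) (G Y)) *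
              Real.exp (lifeCost (dictW (R (K + 1)) C.n₁) (T4PrintedShapeBanking.cost C (K₀ + K + 1) (R (K + 1))) (G Y))) ∧
          (∀ σ, ∀ Y ∈ Old σ, (slot Y).1 < K₀ + jstar K + 1) ∧ (∀ σ, ∀ Y ∈ Old σ, (slot Y).2 ∈ Cell ((K₀ + K + 1) - (slot Y).1)) ∧
          (∀ σ, ∀ Y ∈ Old σ, Consistent C (K₀ + K + 1) (R (K + 1)) (G Y)) ∧ (∀ σ, ∀ Y ∈ Old σ, (G Y).WF (dictW (R (K + 1)) C.n₁)) ∧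
          (∀ σ, ∀ Y ∈ Old σ, K₀ + K + 1 < (G Y).reach (dictW (R (K + 1)) C.n₁)) ∧ (∀ σ, ∀ Y ∈ Old σ, Chrono PEv.step (G Y)) ∧
          (∀ σ, ∀ Y ∈ Old σ, ∀ e ∈ (G Y).events, e.kind = 0 → e.fat < Dcap (K₀ + K + 1)) ∧ (∀ σ, ∀ Y ∈ Old σ, fuel (G Y) ≤ Ncap (K₀ + K + 1)) ∧
          (∀ σ, ∀ Y ∈ Old σ, (G Y).rootStep = (slot Y).1) ∧
          (∀ σ, ∀ j < K₀ + jstar K + 1, ∀ zc ∈ Cell ((K₀ + K + 1) - j), ∀ G₀ ∈ canonFam Dcap Ncap (K₀ + K + 1) j,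
            ((((Old σ).filter fun Y => slot Y = ⟨j, zc⟩ ∧ relabel shape (G Y) = G₀).card : ℕ) : ℝ) ≤ M ^ partnerAges PEv.step G₀)) →
      RelWeightBound 1 (classSetK₁₃ θ K₀ g₀ kr) (weightAK₁₃ θ hP K₀ g₀ os kr) (weightBK₁₃ θ hP K₀ g₀ os kr) (badClassK₁₃ θ K₀ g₀ kr bd)
        (fun K => 1 - Real.exp (-(birthMass C * Real.exp (-C.κ₁) * V *
          ((Λ * Real.exp (ηplus - C.κ₁)) ^ (K - jstar K + 1) / (1 - Λ * Real.exp (ηplus - C.κ₁)))))) := by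
  obtain ⟨x₀, hx₀⟩ := exists_irThreshold C hCv ha hA hL hβ hrq
  refine ⟨x₀, ?_⟩
  intro F N _ θ hP K₀ g₀ os kr bd V Λ ηplus M c hV hΛ hηplus hM hr h1 hside hc jstar hjK hfrac Cell hcell R g β' h27 h29 hR hx1 hxK hprof Dcap Ncap hmA hintA hmB hintB
    hLA hLB
  exact relWeightBound_chronoGenealogies_of_fibreDomLetters θ hP K₀ g₀ os kr bd C hCv.κ₁_nonneg hμ₀ hV hΛ hηplus hM hr h1 hside hc hjK hfrac Cell hcell R g
    (fun K => hx₀ (K₀ + K) (R K) (g K) (β' K) (h27 K) (h29 K) (hR K) (hx1 K) (hxK K)) hprof Dcap Ncap hmA hintA hmB hintB hLA hLB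

end IRThreshold

end YMDAG.UVSplit
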